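import Summits.Ventures.PercRepro.S1PlaneBound

/-!
# PercRepro — THE KILL CHAINS OF RANK 7 ON 11 POINTS (p2, gen 28; SUBCLAIM-S1 §6.10 (xvii)(q))

The up/down extension incidences instantiated on `11` points, in `rkSets` form (`t_k + Σ_m r_{k,m}`), as the
hypotheses of the `(9, 6)` consumers: five upward kills `(11 − k)·#low_k(≤ b) ≤ (k + 1)·#low_{k+1}(≤ b + 1)` and
nine downward kills `(k + 1)·#low_{k+1}(≤ b) ≤ (11 − k)·#low_k(≤ b)`. Nothing is claimed about any cell.

* `kill_up_*`, `kill_down_*` (fourteen instances, each by the template of `S1NineSixRankSevenElevenProfile`).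
Axioms: standard.
-/

open scoped Matroid

namespace PercRepro

namespace S1

open Set

variable {α : Type} {M : Matroid α} [M.Finite]

/-- Upward kill `k = 4`, `b = 3`: `7 · #low_4(≤ 3) ≤ 5 · #low_5(≤ 4)`. -/
theorem kill_up_4_3 (hE : M.E.ncard = 11) (hpairs : ∀ e ∈ M.E, ∀ f ∈ M.E, e ≠ f → M.eRk {e, f} = 2) :
    7 * ((rankTwoSets M 4).ncard + (rkSets M 4 3).ncard) ≤ 5 * ((rankTwoSets M 5).ncard + (rkSets M 5 3).ncard + (rkSets M 5 4).ncard) := by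
  have h := sub_mul_ncard_lowRankSets_le M 4 3
  rw [hE, ncard_lowRankSets_eq hpairs (by norm_num) 3 (by norm_num),
    ncard_lowRankSets_eq hpairs (by norm_num) (3 + 1) (by norm_num)] at h
  simp only [Finset.sum_range_succ, Finset.sum_range_zero, show (3 : ℕ) - 2 = 1 from rfl,
    show (3 + 1 : ℕ) - 2 = 2 from rfl, zero_add] at h
  norm_num at h
  omega

/-- Upward kill `k = 5`, `b = 4`: `6 · #low_5(≤ 4) ≤ 6 · #low_6(≤ 5)`. -/
theorem kill_up_5_4 (hE : M.E.ncard = 11) (hpairs : ∀ e ∈ M.E, ∀ f ∈ M.E, e ≠ f → M.eRk {e, f} = 2) :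
    6 * ((rankTwoSets M 5).ncard + (rkSets M 5 3).ncard + (rkSets M 5 4).ncard) ≤ 6 * ((rankTwoSets M 6).ncard + (rkSets M 6 3).ncard + (rkSets M 6 4).ncard + (rkSets M 6 5).ncard) := by
  have h := sub_mul_ncard_lowRankSets_le M 5 4
  rw [hE, ncard_lowRankSets_eq hpairs (by norm_num) 4 (by norm_num),
    ncard_lowRankSets_eq hpairs (by norm_num) (4 + 1) (by norm_num)] at h
  simp only [Finset.sum_range_succ, Finset.sum_range_zero, show (4 : ℕ) - 2 = 2 from rfl,
    show (4 + 1 : ℕ) - 2 = 3 from rfl, zero_add] at h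
  norm_num at h
  omega

/-- Upward kill `k = 6`, `b = 5`: `5 · #low_6(≤ 5) ≤ 7 · #low_7(≤ 6)`. -/
theorem kill_up_6_5 (hE : M.E.ncard = 11) (hpairs : ∀ e ∈ M.E, ∀ f ∈ M.E, e ≠ f → M.eRk {e, f} = 2) :
    5 * ((rankTwoSets M 6).ncard + (rkSets M 6 3).ncard + (rkSets M 6 4).ncard + (rkSets M 6 5).ncard) ≤ 7 * ((rankTwoSets M 7).ncard + (rkSets M 7 3).ncard + (rkSets M 7 4).ncard + (rkSets M 7 5).ncard + (rkSets M 7 6).ncard) := by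
  have h := sub_mul_ncard_lowRankSets_le M 6 5
  rw [hE, ncard_lowRankSets_eq hpairs (by norm_num) 5 (by norm_num),
    ncard_lowRankSets_eq hpairs (by norm_num) (5 + 1) (by norm_num)] at h
  simp only [Finset.sum_range_succ, Finset.sum_range_zero, show (5 : ℕ) - 2 = 3 from rfl,
    show (5 + 1 : ℕ) - 2 = 4 from rfl, zero_add] at h
  norm_num at h
  omega

/-- Upward kill `k = 7`, `b = 6`: `4 · #low_7(≤ 6) ≤ 8 · #low_8(≤ 7)`. -/
theorem kill_up_7_6 (hE : M.E.ncard = 11) (hpairs : ∀ e ∈ M.E, ∀ f ∈ M.E, e ≠ f → M.eRk {e, f} = 2) :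
    4 * ((rankTwoSets M 7).ncard + (rkSets M 7 3).ncard + (rkSets M 7 4).ncard + (rkSets M 7 5).ncard + (rkSets M 7 6).ncard) ≤ 8 * ((rankTwoSets M 8).ncard + (rkSets M 8 3).ncard + (rkSets M 8 4).ncard + (rkSets M 8 5).ncard + (rkSets M 8 6).ncard + (rkSets M 8 7).ncard) := by
  have h := sub_mul_ncard_lowRankSets_le M 7 6
  rw [hE, ncard_lowRankSets_eq hpairs (by norm_num) 6 (by norm_num),
    ncard_lowRankSets_eq hpairs (by norm_num) (6 + 1) (by norm_num)] at h
  simp only [Finset.sum_range_succ, Finset.sum_range_zero, show (6 : ℕ) - 2 = 4 from rfl,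
    show (6 + 1 : ℕ) - 2 = 5 from rfl, zero_add] at h
  norm_num at h
  omega

/-- Upward kill `k = 8`, `b = 7`: `3 · #low_8(≤ 7) ≤ 9 · #low_9(≤ 8)`. -/
theorem kill_up_8_7 (hE : M.E.ncard = 11) (hpairs : ∀ e ∈ M.E, ∀ f ∈ M.E, e ≠ f → M.eRk {e, f} = 2) :
    3 * ((rankTwoSets M 8).ncard + (rkSets M 8 3).ncard + (rkSets M 8 4).ncard + (rkSets M 8 5).ncard + (rkSets M 8 6).ncard + (rkSets M 8 7).ncard) ≤ 9 * ((rankTwoSets M 9).ncard + (rkSets M 9 3).ncard + (rkSets M 9 4).ncard + (rkSets M 9 5).ncard + (rkSets M 9 6).ncard + (rkSets M 9 7).ncard + (rkSets M 9 8).ncard) := by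
  have h := sub_mul_ncard_lowRankSets_le M 8 7
  rw [hE, ncard_lowRankSets_eq hpairs (by norm_num) 7 (by norm_num),
    ncard_lowRankSets_eq hpairs (by norm_num) (7 + 1) (by norm_num)] at h
  simp only [Finset.sum_range_succ, Finset.sum_range_zero, show (7 : ℕ) - 2 = 5 from rfl,
    show (7 + 1 : ℕ) - 2 = 6 from rfl, zero_add] at h
  norm_num at h
  omega

/-- Downward kill `k = 6`, `b = 4`: `7 · #low_7(≤ 4) ≤ 5 · #low_6(≤ 4)`. -/
theorem kill_down_6_4 (hE : M.E.ncard = 11) (hpairs : ∀ e ∈ M.E, ∀ f ∈ M.E, e ≠ f → M.eRk {e, f} = 2) :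
    7 * ((rankTwoSets M 7).ncard + (rkSets M 7 3).ncard + (rkSets M 7 4).ncard) ≤ 5 * ((rankTwoSets M 6).ncard + (rkSets M 6 3).ncard + (rkSets M 6 4).ncard) := by
  have h := add_one_mul_ncard_lowRankSets_le M 6 4
  rw [hE, ncard_lowRankSets_eq hpairs (by norm_num) 4 (by norm_num),
    ncard_lowRankSets_eq hpairs (by norm_num) 4 (by norm_num)] at h
  simp only [Finset.sum_range_succ, Finset.sum_range_zero, show (4 : ℕ) - 2 = 2 from rfl, zero_add] at h
  norm_num at h
  omega

/-- Downward kill `k = 5`, `b = 4`: `6 · #low_6(≤ 4) ≤ 6 · #low_5(≤ 4)`. -/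
theorem kill_down_5_4 (hE : M.E.ncard = 11) (hpairs : ∀ e ∈ M.E, ∀ f ∈ M.E, e ≠ f → M.eRk {e, f} = 2) :
    6 * ((rankTwoSets M 6).ncard + (rkSets M 6 3).ncard + (rkSets M 6 4).ncard) ≤ 6 * ((rankTwoSets M 5).ncard + (rkSets M 5 3).ncard + (rkSets M 5 4).ncard) := by
  have h := add_one_mul_ncard_lowRankSets_le M 5 4
  rw [hE, ncard_lowRankSets_eq hpairs (by norm_num) 4 (by norm_num),
    ncard_lowRankSets_eq hpairs (by norm_num) 4 (by norm_num)] at h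
  simp only [Finset.sum_range_succ, Finset.sum_range_zero, show (4 : ℕ) - 2 = 2 from rfl, zero_add] at h
  norm_num at h
  omega

/-- Downward kill `k = 4`, `b = 3`: `5 · #low_5(≤ 3) ≤ 7 · #low_4(≤ 3)`. -/
theorem kill_down_4_3 (hE : M.E.ncard = 11) (hpairs : ∀ e ∈ M.E, ∀ f ∈ M.E, e ≠ f → M.eRk {e, f} = 2) :
    5 * ((rankTwoSets M 5).ncard + (rkSets M 5 3).ncard) ≤ 7 * ((rankTwoSets M 4).ncard + (rkSets M 4 3).ncard) := by
  have h := add_one_mul_ncard_lowRankSets_le M 4 3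
  rw [hE, ncard_lowRankSets_eq hpairs (by norm_num) 3 (by norm_num),
    ncard_lowRankSets_eq hpairs (by norm_num) 3 (by norm_num)] at h
  simp only [Finset.sum_range_succ, Finset.sum_range_zero, show (3 : ℕ) - 2 = 1 from rfl, zero_add] at h
  norm_num at h
  omega

/-- Downward kill `k = 6`, `b = 5`: `7 · #low_7(≤ 5) ≤ 5 · #low_6(≤ 5)`. -/
theorem kill_down_6_5 (hE : M.E.ncard = 11) (hpairs : ∀ e ∈ M.E, ∀ f ∈ M.E, e ≠ f → M.eRk {e, f} = 2) :
    7 * ((rankTwoSets M 7).ncard + (rkSets M 7 3).ncard + (rkSets M 7 4).ncard + (rkSets M 7 5).ncard) ≤ 5 * ((rankTwoSets M 6).ncard + (rkSets M 6 3).ncard + (rkSets M 6 4).ncard + (rkSets M 6 5).ncard) := by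
  have h := add_one_mul_ncard_lowRankSets_le M 6 5
  rw [hE, ncard_lowRankSets_eq hpairs (by norm_num) 5 (by norm_num),
    ncard_lowRankSets_eq hpairs (by norm_num) 5 (by norm_num)] at h
  simp only [Finset.sum_range_succ, Finset.sum_range_zero, show (5 : ℕ) - 2 = 3 from rfl, zero_add] at h
  norm_num at h
  omega

/-- Downward kill `k = 7`, `b = 5`: `8 · #low_8(≤ 5) ≤ 4 · #low_7(≤ 5)`. -/
theorem kill_down_7_5 (hE : M.E.ncard = 11) (hpairs : ∀ e ∈ M.E, ∀ f ∈ M.E, e ≠ f → M.eRk {e, f} = 2) :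
    8 * ((rankTwoSets M 8).ncard + (rkSets M 8 3).ncard + (rkSets M 8 4).ncard + (rkSets M 8 5).ncard) ≤ 4 * ((rankTwoSets M 7).ncard + (rkSets M 7 3).ncard + (rkSets M 7 4).ncard + (rkSets M 7 5).ncard) := by
  have h := add_one_mul_ncard_lowRankSets_le M 7 5
  rw [hE, ncard_lowRankSets_eq hpairs (by norm_num) 5 (by norm_num),
    ncard_lowRankSets_eq hpairs (by norm_num) 5 (by norm_num)] at h
  simp only [Finset.sum_range_succ, Finset.sum_range_zero, show (5 : ℕ) - 2 = 3 from rfl, zero_add] at h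
  norm_num at h
  omega

/-- Downward kill `k = 7`, `b = 6`: `8 · #low_8(≤ 6) ≤ 4 · #low_7(≤ 6)`. -/
theorem kill_down_7_6 (hE : M.E.ncard = 11) (hpairs : ∀ e ∈ M.E, ∀ f ∈ M.E, e ≠ f → M.eRk {e, f} = 2) :
    8 * ((rankTwoSets M 8).ncard + (rkSets M 8 3).ncard + (rkSets M 8 4).ncard + (rkSets M 8 5).ncard + (rkSets M 8 6).ncard) ≤ 4 * ((rankTwoSets M 7).ncard + (rkSets M 7 3).ncard + (rkSets M 7 4).ncard + (rkSets M 7 5).ncard + (rkSets M 7 6).ncard) := by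
  have h := add_one_mul_ncard_lowRankSets_le M 7 6
  rw [hE, ncard_lowRankSets_eq hpairs (by norm_num) 6 (by norm_num),
    ncard_lowRankSets_eq hpairs (by norm_num) 6 (by norm_num)] at h
  simp only [Finset.sum_range_succ, Finset.sum_range_zero, show (6 : ℕ) - 2 = 4 from rfl, zero_add] at h
  norm_num at h
  omega

/-- Downward kill `k = 8`, `b = 6`: `9 · #low_9(≤ 6) ≤ 3 · #low_8(≤ 6)`. -/
theorem kill_down_8_6 (hE : M.E.ncard = 11) (hpairs : ∀ e ∈ M.E, ∀ f ∈ M.E, e ≠ f → M.eRk {e, f} = 2) :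
    9 * ((rankTwoSets M 9).ncard + (rkSets M 9 3).ncard + (rkSets M 9 4).ncard + (rkSets M 9 5).ncard + (rkSets M 9 6).ncard) ≤ 3 * ((rankTwoSets M 8).ncard + (rkSets M 8 3).ncard + (rkSets M 8 4).ncard + (rkSets M 8 5).ncard + (rkSets M 8 6).ncard) := by
  have h := add_one_mul_ncard_lowRankSets_le M 8 6
  rw [hE, ncard_lowRankSets_eq hpairs (by norm_num) 6 (by norm_num),
    ncard_lowRankSets_eq hpairs (by norm_num) 6 (by norm_num)] at h
  simp only [Finset.sum_range_succ, Finset.sum_range_zero, show (6 : ℕ) - 2 = 4 from rfl, zero_add] at h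
  norm_num at h
  omega

/-- Downward kill `k = 5`, `b = 3`: `6 · #low_6(≤ 3) ≤ 6 · #low_5(≤ 3)`. -/
theorem kill_down_5_3 (hE : M.E.ncard = 11) (hpairs : ∀ e ∈ M.E, ∀ f ∈ M.E, e ≠ f → M.eRk {e, f} = 2) :
    6 * ((rankTwoSets M 6).ncard + (rkSets M 6 3).ncard) ≤ 6 * ((rankTwoSets M 5).ncard + (rkSets M 5 3).ncard) := by
  have h := add_one_mul_ncard_lowRankSets_le M 5 3
  rw [hE, ncard_lowRankSets_eq hpairs (by norm_num) 3 (by norm_num),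
    ncard_lowRankSets_eq hpairs (by norm_num) 3 (by norm_num)] at h
  simp only [Finset.sum_range_succ, Finset.sum_range_zero, show (3 : ℕ) - 2 = 1 from rfl, zero_add] at h
  norm_num at h
  omega

/-- Downward kill `k = 3`, `b = 3`: `4 · #low_4(≤ 3) ≤ 8 · #low_3(≤ 3)`. -/
theorem kill_down_3_3 (hE : M.E.ncard = 11) (hpairs : ∀ e ∈ M.E, ∀ f ∈ M.E, e ≠ f → M.eRk {e, f} = 2) :
    4 * ((rankTwoSets M 4).ncard + (rkSets M 4 3).ncard) ≤ 8 * ((rankTwoSets M 3).ncard + (rkSets M 3 3).ncard) := by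
  have h := add_one_mul_ncard_lowRankSets_le M 3 3
  rw [hE, ncard_lowRankSets_eq hpairs (by norm_num) 3 (by norm_num),
    ncard_lowRankSets_eq hpairs (by norm_num) 3 (by norm_num)] at h
  simp only [Finset.sum_range_succ, Finset.sum_range_zero, show (3 : ℕ) - 2 = 1 from rfl, zero_add] at h
  norm_num at h
  omega

end S1

end PercRepro
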